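import Summits.CriticalPhenomena.PercolationContinuityZ3.Theorems.PercNearOneGluingNoHeavyLowerTailKnQuestion8CoefficientwiseParallelClosure
import Literature.Probability.Percolation.GhostFieldMagnetization
import HarnessLib

/-!
# Root-edge domination (REM) on the NC* event and its reduction to the LEAK LEMMA — prim-lf-2 gen 66

Support file (`--supports stmt-CriticalPhenomena-4575`, closed), prover `prim-lf-2` (gen 66).  No definitions, no named facts, no sorries; standard axioms.
Memo `prim-lf-2/CW-BASE-gen66.md` §7 (the edge-cluster family) and §7.6 (the leak lemma).

Setting (CONJECTURE NC*, prim-lf-2 gens 63–66): finite multigraph `ends : ι → Sym2 V`, edge set `E`, root `x`, target set `W ∌ x`, `C_v(s) = openCluster (ends '' s) v`,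
no-core event `Ev_W(s) :⟺ ∀ w ∈ W, ¬(w ∈ C_x(s) ∧ w ∈ C_x(E∖s))`.  NC* says `Σ_{Ev_W} (f(C_x s) − f(C_x(E∖s)))(g(…) − g(…)) ≥ 0`.

**CONJECTURE (REM) — root-edge monotonicity / domination** (prim-lf-2 gen 66, memo §7): for a ROOT edge `e` (ends `{x,p}`, `p ≠ x`) and every monotone `g`,
  `REM_E(e; x, W)[g] := Σ_{s ⊆ E : e ∈ s, Ev_W(s)} (g(C_x s) − g(C_x(E∖s))) ≥ 0`
('given the no-core event and a red root edge, the red cluster of `x` stochastically dominates the blue one').  It is the simplest member of the family of 'red-edge-cluster-measurable'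
conditionings under which `K ≽ B` survives on `Ev_W` (NC* itself is the member 'conditioning on `K ∈ U`').  Census (exact, one min-closure per test): all rooted connected graphs on ≤ 7
vertices (m ≤ 15) × all `W` × all root edges (856 230 tests), all rooted 2-connected graphs on 8 vertices with m ≤ 12 (1 524 635 tests), random multigraphs: 0 failures; it FAILS for
non-root edges and for non-flip-symmetric events.
* `Coefficientwise.rem_eq_sum_erase` — resolving the colour of `e`: with `E' = E.erase e`, `K₀ = C_x(t)`, `P = C_p(t)`, `B₀ = C_x(E'∖t)` (clusters in `G − e`),
  `REM = Σ_{t ⊆ E' : ∀ w∈W, ¬(w ∈ K₀ ∪ P ∧ w ∈ B₀)} (g(K₀ ∪ P) − g(B₀))` — a two-source linear form on `G − e` (valid for every `g`).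
* `Coefficientwise.rem_nonneg_of_empty` — the case `W = ∅` (no conditioning): `REM ≥ 0` for monotone `g` (flip on `G − e` plus `K₀ ⊆ K₀ ∪ P`).
* `Coefficientwise.rem_nonneg_of_leak` — **REDUCTION (REM) ⟸ (L)**: with the flip identity `Σ_{t : Ev_W on G−e} (g K₀ − g B₀) = 0`,
  `REM = Σ_{GAIN} (g(K₀∪P) − g K₀) + Σ_{LEAK} (g B₀ − g K₀)`, `LEAK = {p ∉ K₀} ∩ {∀ w∈W, ¬(w∈K₀ ∧ w∈B₀)} ∩ {∃ w∈W, w ∈ P ∧ w ∈ B₀}`; hence the LEAK LEMMA (L) 'on LEAK, `B₀ ≽ K₀`'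
  (`0 ≤ Σ_{LEAK}(g B₀ − g K₀)`, conjectured; exact census n ≤ 6 all graphs and n = 7, m ≤ 8: 0 failures; its variants without the no-core condition are theorems by conditioning on `C_p`)
  implies `REM ≥ 0`.
[cite: KozmaNitzan2024, Questions 8–9 (§5.5 p. 36) (context: the Question-8 pocket covariance programme)]
-/

namespace Summit.CriticalPhenomena.PercolationContinuityZ3.Theorems

open Finset Literature.Probability.Percolation

namespace Coefficientwise

variable {ι V : Type*} [DecidableEq ι] (ends : ι → Sym2 V)

/-- Adding a root edge `e = {x,p}` to the red edges merges the red clusters of `x` and `p`: `C_x(t ∪ {e}) = C_x(t) ∪ C_p(t)`.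
[cite: KozmaNitzan2024, §5.5 (context only; folklore)] -/
theorem openCluster_insert_rootEdge_union (t : Finset ι) {e : ι} {x p : V} (he : ends e = s(x, p)) (hpx : p ≠ x) :
    openCluster (ends '' (↑(insert e t) : Set ι)) x = openCluster (ends '' (↑t : Set ι)) x ∪ openCluster (ends '' (↑t : Set ι)) p := by
  have himg : ends '' (↑(insert e t) : Set ι) = insert s(x, p) (ends '' (↑t : Set ι)) := by
    rw [Finset.coe_insert, Set.image_insert_eq, he]
  rw [himg]
  have hmono : ∀ {a b : V}, (openGraph (ends '' (↑t : Set ι))).Reachable a b →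
      (openGraph (insert s(x, p) (ends '' (↑t : Set ι)))).Reachable a b :=
    fun h => h.mono (openGraph_mono (Set.subset_insert _ _))
  ext y
  constructor
  · intro hy
    rcases GhostField.reachable_insert_cases hy with h | ⟨-, h⟩ | ⟨-, h⟩
    · exact Or.inl h
    · exact Or.inr h
    · exact Or.inl h
  · rintro (h | h)
    · exact hmono h
    · exact (GhostField.reachable_insert_endpoints _ hpx.symm).trans (hmono h)

omit [DecidableEq ι] in
/-- If `p` lies in the red cluster of `x` then the red cluster of `p` is contained in it. [cite: KozmaNitzan2024, §5.5 (context only; folklore)] -/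
theorem openCluster_subset_of_mem {t : Finset ι} {x p : V} (hp : p ∈ openCluster (ends '' (↑t : Set ι)) x) :
    openCluster (ends '' (↑t : Set ι)) p ⊆ openCluster (ends '' (↑t : Set ι)) x :=
  fun _ hy => SimpleGraph.Reachable.trans hp hy

section sums

open Classical in
/-- **Resolving the root edge.**  For `e ∈ E` with ends `{x,p}`, `p ≠ x`, `E' = E.erase e`, and every `g`:
`Σ_{s ⊆ E : e ∈ s, Ev_W(s)} (g(C_x s) − g(C_x(E∖s))) = Σ_{t ⊆ E' : ∀ w∈W, ¬(w ∈ C_x t ∪ C_p t ∧ w ∈ C_x(E'∖t))} (g(C_x t ∪ C_p t) − g(C_x(E'∖t)))`.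
[cite: KozmaNitzan2024, Questions 8–9 (§5.5 p. 36) (context)] -/
theorem rem_eq_sum_erase (E : Finset ι) {e : ι} (he : e ∈ E) {x p : V} (hxp : ends e = s(x, p)) (hpx : p ≠ x)
    (W : Set V) (g : Set V → ℝ) :
    ∑ s ∈ E.powerset.filter (fun s : Finset ι => e ∈ s ∧
          ∀ w ∈ W, ¬ (w ∈ openCluster (ends '' (↑s : Set ι)) x ∧ w ∈ openCluster (ends '' (↑(E \ s) : Set ι)) x)),
      (g (openCluster (ends '' (↑s : Set ι)) x) - g (openCluster (ends '' (↑(E \ s) : Set ι)) x)) =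
    ∑ t ∈ (E.erase e).powerset.filter (fun t : Finset ι =>
          ∀ w ∈ W, ¬ (w ∈ openCluster (ends '' (↑t : Set ι)) x ∪ openCluster (ends '' (↑t : Set ι)) p ∧
            w ∈ openCluster (ends '' (↑((E.erase e) \ t) : Set ι)) x)),
      (g (openCluster (ends '' (↑t : Set ι)) x ∪ openCluster (ends '' (↑t : Set ι)) p) -
        g (openCluster (ends '' (↑((E.erase e) \ t) : Set ι)) x)) := by
  set E' : Finset ι := E.erase e with hE'
  have heE' : e ∉ E' := Finset.notMem_erase e E
  have hE : E = insert e E' := by rw [hE', Finset.insert_erase he]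
  -- complements
  have cR : ∀ t, t ⊆ E' → insert e E' \ insert e t = E' \ t := by
    intro t ht; ext i
    simp only [Finset.mem_sdiff, Finset.mem_insert, not_or]
    constructor
    · rintro ⟨h1, h2, h3⟩
      rcases h1 with h1 | h1
      · exact absurd h1 h2
      · exact ⟨h1, h3⟩
    · rintro ⟨h1, h2⟩
      exact ⟨Or.inr h1, fun h => heE' (h ▸ h1), h2⟩
  rw [Finset.sum_filter, Finset.sum_filter, hE, Finset.sum_powerset_insert heE']
  -- the part with `e ∉ s` vanishes
  have h0 : ∑ t ∈ E'.powerset, (if (e ∈ t ∧ ∀ w ∈ W, ¬ (w ∈ openCluster (ends '' (↑t : Set ι)) x ∧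
      w ∈ openCluster (ends '' (↑(insert e E' \ t) : Set ι)) x)) then
      (g (openCluster (ends '' (↑t : Set ι)) x) - g (openCluster (ends '' (↑(insert e E' \ t) : Set ι)) x)) else 0) = 0 := by
    refine Finset.sum_eq_zero fun t ht => ?_
    have het : e ∉ t := fun h => heE' (Finset.mem_powerset.mp ht h)
    rw [if_neg (fun h => het h.1)]
  rw [h0, zero_add]
  refine Finset.sum_congr rfl fun t ht => ?_
  have htE : t ⊆ E' := Finset.mem_powerset.mp ht
  rw [cR t htE, openCluster_insert_rootEdge_union ends t hxp hpx]
  have hmem : (e ∈ insert e t ∧ ∀ w ∈ W, ¬ (w ∈ openCluster (ends '' (↑t : Set ι)) x ∪ openCluster (ends '' (↑t : Set ι)) p ∧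
      w ∈ openCluster (ends '' (↑(E' \ t) : Set ι)) x)) ↔
      (∀ w ∈ W, ¬ (w ∈ openCluster (ends '' (↑t : Set ι)) x ∪ openCluster (ends '' (↑t : Set ι)) p ∧
      w ∈ openCluster (ends '' (↑(E' \ t) : Set ι)) x)) :=
    ⟨fun h => h.2, fun h => ⟨Finset.mem_insert_self e t, h⟩⟩
  exact if_congr hmem rfl rfl

open Classical in
/-- **(REM) with no targets** (`W = ∅`, no conditioning): `Σ_{s ⊆ E : e ∈ s} (g(C_x s) − g(C_x(E∖s))) ≥ 0` for a root edge `e = {x,p}` and monotone `g` — resolve `e`, then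
`g(C_x t ∪ C_p t) ≥ g(C_x t)` and the flip `t ↦ E'∖t` on `G − e`.  [cite: KozmaNitzan2024, Questions 8–9 (§5.5 p. 36) (context)] -/
theorem rem_nonneg_of_empty (E : Finset ι) {e : ι} (he : e ∈ E) {x p : V} (hxp : ends e = s(x, p)) (hpx : p ≠ x)
    (g : Set V → ℝ) (hg : Monotone g) :
    0 ≤ ∑ s ∈ E.powerset.filter (fun s : Finset ι => e ∈ s ∧
          ∀ w ∈ (∅ : Set V), ¬ (w ∈ openCluster (ends '' (↑s : Set ι)) x ∧ w ∈ openCluster (ends '' (↑(E \ s) : Set ι)) x)),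
      (g (openCluster (ends '' (↑s : Set ι)) x) - g (openCluster (ends '' (↑(E \ s) : Set ι)) x)) := by
  rw [rem_eq_sum_erase ends E he hxp hpx ∅ g]
  set E' : Finset ι := E.erase e with hE'
  have htriv : ∀ t : Finset ι, (∀ w ∈ (∅ : Set V), ¬ (w ∈ openCluster (ends '' (↑t : Set ι)) x ∪ openCluster (ends '' (↑t : Set ι)) p ∧
      w ∈ openCluster (ends '' (↑(E' \ t) : Set ι)) x)) := fun t w hw => absurd hw (Set.notMem_empty w)
  rw [Finset.filter_true_of_mem (fun t _ => htriv t)]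
  -- flip identity Σ g(C_x(E'∖t)) = Σ g(C_x t)
  have hflip : ∑ t ∈ E'.powerset, g (openCluster (ends '' (↑(E' \ t) : Set ι)) x) =
      ∑ t ∈ E'.powerset, g (openCluster (ends '' (↑t : Set ι)) x) := by
    have h := sum_powerset_filter_sdiff (E := E') (Q := fun _ : Finset ι => True) (fun _ _ => Iff.rfl)
      (fun t => g (openCluster (ends '' (↑t : Set ι)) x))
    rw [Finset.filter_true_of_mem (fun _ _ => trivial)] at h
    exact h
  rw [Finset.sum_sub_distrib, hflip, ← Finset.sum_sub_distrib]
  refine Finset.sum_nonneg fun t _ => ?_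
  exact sub_nonneg.mpr (hg Set.subset_union_left)

open Classical in
/-- **REDUCTION: the LEAK LEMMA (L) implies (REM).**  Let `e ∈ E` have ends `{x,p}`, `p ≠ x`, `E' = E.erase e`, and write `K₀ = C_x(t)`, `P = C_p(t)`, `B₀ = C_x(E'∖t)` for `t ⊆ E'`.
If (L) `0 ≤ Σ_{t ⊆ E' : p ∉ K₀, (∀ w∈W, ¬(w∈K₀ ∧ w∈B₀)), (∃ w∈W, w∈P ∧ w∈B₀)} (g(B₀) − g(K₀))` ('on the leak event the blue cluster of `x` dominates the red one'), then for monotone `g`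
`0 ≤ REM_E(e; x, W)[g] = Σ_{s ⊆ E : e ∈ s, Ev_W(s)} (g(C_x s) − g(C_x(E∖s)))`.  Proof: resolve `e` (`rem_eq_sum_erase`), subtract the flip identity `Σ_{Ev_W on G−e}(g K₀ − g B₀) = 0`, and
check termwise that the difference is the nonnegative gain `g(K₀∪P) − g(K₀)` on `{p∉K₀} ∩ Ev₁` and the leak summand `g B₀ − g K₀` on LEAK (zero elsewhere).
[cite: KozmaNitzan2024, Questions 8–9 (§5.5 p. 36) (context)] -/
theorem rem_nonneg_of_leak (E : Finset ι) {e : ι} (he : e ∈ E) {x p : V} (hxp : ends e = s(x, p)) (hpx : p ≠ x)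
    (W : Set V) (g : Set V → ℝ) (hg : Monotone g)
    (hL : 0 ≤ ∑ t ∈ (E.erase e).powerset.filter (fun t : Finset ι =>
          p ∉ openCluster (ends '' (↑t : Set ι)) x ∧
          (∀ w ∈ W, ¬ (w ∈ openCluster (ends '' (↑t : Set ι)) x ∧ w ∈ openCluster (ends '' (↑((E.erase e) \ t) : Set ι)) x)) ∧
          (∃ w ∈ W, w ∈ openCluster (ends '' (↑t : Set ι)) p ∧ w ∈ openCluster (ends '' (↑((E.erase e) \ t) : Set ι)) x)),
        (g (openCluster (ends '' (↑((E.erase e) \ t) : Set ι)) x) - g (openCluster (ends '' (↑t : Set ι)) x))) :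
    0 ≤ ∑ s ∈ E.powerset.filter (fun s : Finset ι => e ∈ s ∧
          ∀ w ∈ W, ¬ (w ∈ openCluster (ends '' (↑s : Set ι)) x ∧ w ∈ openCluster (ends '' (↑(E \ s) : Set ι)) x)),
      (g (openCluster (ends '' (↑s : Set ι)) x) - g (openCluster (ends '' (↑(E \ s) : Set ι)) x)) := by
  rw [rem_eq_sum_erase ends E he hxp hpx W g]
  set E' : Finset ι := E.erase e with hE'
  -- abbreviations
  set K : Finset ι → Set V := fun t => openCluster (ends '' (↑t : Set ι)) x with hK
  set Pc : Finset ι → Set V := fun t => openCluster (ends '' (↑t : Set ι)) p with hPc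
  have hB : ∀ t : Finset ι, openCluster (ends '' (↑(E' \ t) : Set ι)) x = K (E' \ t) := fun t => rfl
  -- the flip identity on `G − e`
  have hflip : ∑ t ∈ E'.powerset.filter (fun t : Finset ι => ∀ w ∈ W, ¬ (w ∈ K t ∧ w ∈ K (E' \ t))),
      (g (K t) - g (K (E' \ t))) = 0 := by
    have hsym : ∀ t, t ⊆ E' → ((∀ w ∈ W, ¬ (w ∈ K (E' \ t) ∧ w ∈ K (E' \ (E' \ t)))) ↔ (∀ w ∈ W, ¬ (w ∈ K t ∧ w ∈ K (E' \ t)))) := by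
      intro t ht
      rw [Finset.sdiff_sdiff_eq_self ht]
      exact forall₂_congr fun w _ => not_congr and_comm
    have h := sum_powerset_filter_sdiff (E := E') (Q := fun t : Finset ι => ∀ w ∈ W, ¬ (w ∈ K t ∧ w ∈ K (E' \ t))) hsym (fun t => g (K t))
    rw [Finset.sum_sub_distrib, sub_eq_zero]
    exact h.symm
  -- rewrite everything as sums over `E'.powerset` of if-then-else summands
  rw [Finset.sum_filter] at hflip hL ⊢
  -- termwise comparison: REM summand − flip summand − leak summand ≥ 0
  have key : ∀ t ∈ E'.powerset,
      0 ≤ (if (∀ w ∈ W, ¬ (w ∈ K t ∪ Pc t ∧ w ∈ K (E' \ t))) then (g (K t ∪ Pc t) - g (K (E' \ t))) else 0)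
        - (if (∀ w ∈ W, ¬ (w ∈ K t ∧ w ∈ K (E' \ t))) then (g (K t) - g (K (E' \ t))) else 0)
        - (if (p ∉ K t ∧ (∀ w ∈ W, ¬ (w ∈ K t ∧ w ∈ K (E' \ t))) ∧ (∃ w ∈ W, w ∈ Pc t ∧ w ∈ K (E' \ t)))
            then (g (K (E' \ t)) - g (K t)) else 0) := by
    intro t _
    by_cases hp : p ∈ K t
    · -- `P ⊆ K₀`: the first two summands coincide, the leak summand vanishes
      have hsub : Pc t ⊆ K t := openCluster_subset_of_mem ends hp
      have hKP : K t ∪ Pc t = K t := Set.union_eq_self_of_subset_right hsub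
      have hnl : ¬ (p ∉ K t ∧ (∀ w ∈ W, ¬ (w ∈ K t ∧ w ∈ K (E' \ t))) ∧ (∃ w ∈ W, w ∈ Pc t ∧ w ∈ K (E' \ t))) := fun h => h.1 hp
      rw [hKP, if_neg hnl, sub_zero, sub_self]
    · by_cases h1 : ∀ w ∈ W, ¬ (w ∈ K t ∪ Pc t ∧ w ∈ K (E' \ t))
      · have h0 : ∀ w ∈ W, ¬ (w ∈ K t ∧ w ∈ K (E' \ t)) := fun w hw h => h1 w hw ⟨Or.inl h.1, h.2⟩
        have hnl : ¬ (p ∉ K t ∧ (∀ w ∈ W, ¬ (w ∈ K t ∧ w ∈ K (E' \ t))) ∧ (∃ w ∈ W, w ∈ Pc t ∧ w ∈ K (E' \ t))) := by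
          rintro ⟨-, -, w, hw, hwP, hwB⟩
          exact h1 w hw ⟨Or.inr hwP, hwB⟩
        rw [if_pos h1, if_pos h0, if_neg hnl, sub_zero]
        have hmono : g (K t) ≤ g (K t ∪ Pc t) := hg Set.subset_union_left
        linarith
      · rw [if_neg h1]
        by_cases h0 : ∀ w ∈ W, ¬ (w ∈ K t ∧ w ∈ K (E' \ t))
        · -- leak: some target in `P ∩ B₀`
          have hleak : ∃ w ∈ W, w ∈ Pc t ∧ w ∈ K (E' \ t) := by
            by_contra hne
            apply h1
            intro w hw hh
            rcases hh with ⟨hKP, hB0⟩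
            rcases hKP with hk | hpc
            · exact h0 w hw ⟨hk, hB0⟩
            · exact hne ⟨w, hw, hpc, hB0⟩
          rw [if_pos h0, if_pos ⟨hp, h0, hleak⟩]
          linarith
        · have hnl : ¬ (p ∉ K t ∧ (∀ w ∈ W, ¬ (w ∈ K t ∧ w ∈ K (E' \ t))) ∧ (∃ w ∈ W, w ∈ Pc t ∧ w ∈ K (E' \ t))) :=
            fun h => h0 h.2.1
          rw [if_neg h0, if_neg hnl]
          simp
  have hsum := Finset.sum_nonneg key
  rw [Finset.sum_sub_distrib, Finset.sum_sub_distrib, hflip, sub_zero] at hsum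
  linarith

end sums

end Coefficientwise

end Summit.CriticalPhenomena.PercolationContinuityZ3.Theorems
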